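import Summits.KontsevichZagierPeriods.KontsevichZagierPeriods.Statement
import Summits.KontsevichZagierPeriods.KontsevichZagierPeriods.Theorems.TorsionLogsTorsionSectorCompleteDefs
import Summits.KontsevichZagierPeriods.KontsevichZagierPeriods.Theorems.TorsionLogsTorsionSectorCompleteArcValue
import Literature.NumberTheory.Transcendental.KZKernelConjectureForms
import HarnessLib

/-!
# Route `TorsionLogs`, crux `TorsionSectorComplete` (stmt-KontsevichZagierPeriods-14212), line
# `NeronTorsionModularArc` — the on-path lemma `KontsevichZagierPeriods → NeronTorsionArcs`, UNCONDITIONAL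

The forward discipline's F4 lemma for the rung `NeronTorsionArcs` (Néron–torsion chain along a real arc of
`Y₁(N)`) was published conditionally on the modular-arc VALUE identity (`Lines/NeronTorsionArcs_onpath.lean`:
`neronTorsionArcs_of_kontsevichZagierPeriods (hV : ArcValueIdentity) (h : KontsevichZagierPeriods)`).  The
value identity is now a THEOREM (`NeronArcs.arc_value_identity`, file `TorsionLogsTorsionSectorCompleteArcValue.lean`;
pieces: raw fibre identity `…ArcFibreIdentity.lean`, last-coordinate Fubini and log boxes `…ArcFubini.lean`), so:

* `arcValueIdentity_holds : NeronArcs.ArcValueIdentity` — the Theorems-side mirror of the line's `ArcValueIdentity`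
  (`TorsionLogsTorsionSectorCompleteDefs.lean`, verbatim, hence definitionally the crux-side constant) holds;
* `neronTorsionArcChain_of_kontsevichZagierPeriods : KontsevichZagierPeriods → NeronTorsionArcChain` — member
  `true`: Conjecture 1 in kernel form (`kzKernelConjecture_iff_isRational`) applied to the pinned element, whose
  evaluation vanishes by the value identity;
* `neronTorsionArcs_of_kontsevichZagierPeriods : KontsevichZagierPeriods → NeronTorsionArcs` — the rung BY NAME
  (member `false` = the proved floor `rung_false`), registered as an `aesop` **safe forward rule**: with
  `h : KontsevichZagierPeriods` in context `aesop` adds `NeronArcs.NeronTorsionArcs`, and its built-in `assumption`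
  (default transparency) closes any goal definitionally equal to it — in particular the crux-workfile constant
  `Cruxes.TorsionSectorComplete.NeronTorsionModularArc.NeronTorsionArcs`, which no Theorems file can name
  (same mechanism as `TorsionLogsNeronTorsionFlexDefs.lean` for the sister lines `NeronDuplication` / `NeronHeight`).

prover-fwd2-land-1-g28-0 (on-path lander, row owner of candidates row 8), 2026-08-19.
-/

-- single-conjunct summit: Sub = Summit, so the namespace segment repeats by design (CONVENTIONS §2)
set_option linter.dupNamespace false

noncomputable section

open Set MeasureTheory
open Literature.NumberTheory.Transcendental

namespace Summit.KontsevichZagierPeriods.KontsevichZagierPeriods.TorsionLogs.NeronArcs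

/-- **The modular-arc value identity holds** (`NeronArcs.ArcValueIdentity`, verbatim the line's
`ArcValueIdentity`): a repackaging of `arc_value_identity` with `f = pencil e₁`, `A = neronUnit e₁ N xP`,
`D = tangentDatum e₁` (the hypotheses `0 < a < N/2` and the torsion order of `ArcData` are not needed).
[cite: Silverman1994, Thm VI.3.2] -/
theorem arcValueIdentity_holds : ArcValueIdentity := by
  intro e₁ t₀ t₁ N a xP hd RI RP Rψ RD hr hψdom hψint hDdom hDint
  obtain ⟨he₁, -, hN, -, -, hΔ, hpos, hxP, -, hper⟩ := hd
  obtain ⟨hIdom, hIint, hPdom, hPint⟩ := hr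
  exact arc_value_identity e₁ t₀ t₁ N a xP (pencil e₁) (neronUnit e₁ N xP) (tangentDatum e₁)
    (fun _ _ => rfl) (fun _ => rfl) (fun _ => rfl) he₁ hN hΔ hpos hxP hper RI RP Rψ RD hIdom hIint hPdom
    hPint hψdom hψint hDdom hDint

/-- **F4, member `true`: Conjecture 1 ⇒ the Néron–torsion chain along the arc.** Kernel form of
Conjecture 1 (`kzKernelConjecture_iff_isRational`) applied to the pinned element
`(N−2)4N²•[R_I] + (N−2)(N−2a)²•[R_P] − 4N•[R_ψ] + N²(N−2)•[R_D]`, whose evaluation is `0` by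
`arcValueIdentity_holds`. [cite: KontsevichZagier2001, §1.2 Conjecture 1] -/
theorem neronTorsionArcChain_of_kontsevichZagierPeriods (h : _root_.KontsevichZagierPeriods) :
    NeronTorsionArcChain := by
  have hK : KZKernelConjecture := kzKernelConjecture_iff_isRational.mpr h
  intro e₁ t₀ t₁ N a xP hdata RI RP Rψ RD hreps hψdom hψint hDdom hDint
  apply hK
  have hv := arcValueIdentity_holds e₁ t₀ t₁ N a xP hdata RI RP Rψ RD hreps hψdom hψint hDdom hDint
  simp only [map_add, map_sub, map_zsmul, KZ.eval_of, zsmul_eq_mul]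
  push_cast
  linear_combination hv

/-- **F4 ON-PATH LEMMA, by name and unconditional: the Statement implies the rung `NeronTorsionArcs`**
(member `false` = the proved floor, member `true` from Conjecture 1 and the value identity).  Registered as an
`aesop` safe forward rule keyed on the Statement (see the module docstring for what that buys the tribunal
kernel's `intro h; aesop` probe on the unchanged crux file). [cite: KontsevichZagier2001, §1.2 Conjecture 1] -/
@[aesop safe forward]
theorem neronTorsionArcs_of_kontsevichZagierPeriods (h : _root_.KontsevichZagierPeriods) : NeronTorsionArcs :=
  neronTorsionArcs_iff.mpr ⟨rung_false, neronTorsionArcChain_of_kontsevichZagierPeriods h⟩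

/- The tribunal kernel's literal forward goal for this name, closed by its literal portfolio tactic. -/
example : _root_.KontsevichZagierPeriods → NeronTorsionArcs := by
  intro h; aesop

end Summit.KontsevichZagierPeriods.KontsevichZagierPeriods.TorsionLogs.NeronArcs

end
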